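import Mathlib.Combinatorics.Nullstellensatz
import Mathlib.LinearAlgebra.Basis.VectorSpace
import Mathlib.LinearAlgebra.Pi
import Mathlib.Algebra.MvPolynomial.Funext
import Mathlib.Algebra.MvPolynomial.Monad
import Mathlib.Algebra.CharZero.Infinite
import Mathlib.Data.Fintype.BigOperators
import HarnessLib

/-!
# Bürgisser's simplex lemma (TCS 2000, Lemma 4.2): lattice points of a simplex are not covered by few proper subspaces

Trunk T-CPLX-ALG. P. Bürgisser, *Cook's versus Valiant's hypothesis*, Theoret. Comput. Sci. 235
(2000) 71–88, Lemma 4.2 (p. 80): "Let `U_1, …, U_t` be proper linear subspaces of `ℚ^{s+1}` and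
let `Δ_s(t) = {a ∈ ℕ^{s+1} | ∑_{σ=0}^s a_σ = t}` be the set of lattice points of an `s`-dimensional
simplex. Then we have `Δ_s(t) ⊄ U_1 ∪ U_2 ∪ ⋯ ∪ U_t`." This is the combinatorial input of
Lemmas 4.3 and 4.4 of the paper (small non-negative integer combinations `∑_σ a_σ f_σ` avoiding the
"bad" subspaces attached to the top-dimensional components, resp. small integer hyperplanes), hence
of Theorem 4.5 (the named fact `algebraicSolution_height_bound` of
`BurgisserReductionModPrimes.lean`, ingredient (A) "zero-dimensional reduction with small weight"
of `BurgisserReductionModPrimesProofs.lean`) in the tree's proof of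
`PPoly_eq_polyAdvice_NP_of_VP_eq_VNP` (TCS Cor. 1.2(1)). The lemma is PROVED here
(`exists_simplexLatticePoint_forall_not_mem`), over any field of characteristic zero in place of
`ℚ` and any finite index type in place of `{0, …, s}`.

## Proof

The printed proof is an induction on `s + t`. We give instead a direct proof by the polynomial
method, which is shorter to formalise with Mathlib: each proper subspace `U_τ` lies in the kernel
of a nonzero linear functional `f_τ` (`Submodule.exists_le_ker_of_lt_top`); the product
`P = ∏_τ f_τ`, written as a polynomial (`∏_τ ∑_j f_τ(e_j) X_j`), is nonzero of total degree `≤ t`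
and satisfies `P(c x) = c^t P(x)`. Dehomogenise along the hyperplane `∑_j x_j = t`:
`Q(x') = P(t − ∑_{j ≠ j₀} x_j, x')` has total degree `≤ t` and is nonzero (otherwise `P` vanishes
on the hyperplane, hence by scaling wherever `∑_j x_j ≠ 0`, so `P · ∑_j X_j = 0` as a function on
the infinite field, so `P = 0`). Alon's Combinatorial Nullstellensatz
(`MvPolynomial.combinatorial_nullstellensatz_exists_eval_nonzero`, Mathlib), applied to a monomial
`x^{m₀}` of top degree of `Q` and the grids `{0, 1, …, m₀(j)} ⊂ K`, gives natural numbers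
`n_j ≤ m₀(j)` (`j ≠ j₀`) with `Q(n) ≠ 0`; then `∑_{j ≠ j₀} n_j ≤ |m₀| = deg Q ≤ t`, and the lattice
point `a = (t − ∑ n_j, n)` of `Δ(t)` has `P(a) = Q(n) ≠ 0`, i.e. `f_τ(a) ≠ 0` for every `τ`, so
`a ∉ U_τ`.

## Content

* `eval_sum_C_mul_X_eq_apply` — the polynomial `∑_j f(e_j) X_j` evaluates to the functional `f`;
* `exists_simplexLatticePoint_forall_not_mem` — **Lemma 4.2** for a family `U : Fin t → Submodule K (ι → K)`
  of proper subspaces: some `a : ι → ℕ` with `∑ a = t` has `(a : ι → K) ∉ U τ` for all `τ`;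
* `exists_simplexLatticePoint_forall_not_mem_finset` — the same for a finset of at most `t` proper
  subspaces (`ι` nonempty).

What is NOT here: the optimality remark (`t + 1` proper subspaces suffice to cover `Δ_s(t)`), and
Lemmas 4.3–4.4 themselves (they need Bézout's inequality for the number of top-dimensional
components, not available in Mathlib).

## References

* [Burgisser2000TCS] P. Bürgisser, Cook's versus Valiant's hypothesis, Theoret. Comput. Sci. 235
  (2000) 71–88, Lemma 4.2, p. 80.
* N. Alon, Combinatorial Nullstellensatz, Combin. Probab. Comput. 8 (1999) 7–29, Thm. 1.2
  (Mathlib `Mathlib.Combinatorics.Nullstellensatz`).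
-/

noncomputable section

open MvPolynomial Finset

namespace Literature.Computability.AlgebraicComplexity

variable {K : Type*} [Field K] {ι : Type*} [Fintype ι] [DecidableEq ι]

/-- The degree-one polynomial `∑_j f(e_j) X_j ∈ K[X_j : j ∈ ι]` attached to a linear functional
`f` on `K^ι` evaluates at `x` to `f(x)` (expansion in the standard basis). [folklore] -/
theorem eval_sum_C_mul_X_eq_apply (f : (ι → K) →ₗ[K] K) (x : ι → K) :
    eval x (∑ j, C (f fun j' => if j = j' then 1 else 0) * X j) = f x := by
  rw [LinearMap.pi_apply_eq_sum_univ f x, map_sum]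
  refine Finset.sum_congr rfl fun j _ => ?_
  rw [map_mul, eval_C, eval_X, smul_eq_mul, mul_comm]

omit [DecidableEq ι] in
/-- The polynomial `∑_j c_j X_j` has total degree at most `1` (cf. `totalDegree_sum_C_mul_X_le`
of `PowerSumNonvanishing.lean`, restated privately to keep this file's imports within Mathlib).
[folklore] -/
private theorem totalDegree_sum_C_mul_X_le_one (c : ι → K) :
    (∑ j, C (c j) * X j : MvPolynomial ι K).totalDegree ≤ 1 := by
  refine (totalDegree_finsetSum _ _).trans (Finset.sup_le fun j _ => ?_)
  refine (totalDegree_mul _ _).trans ?_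
  rw [totalDegree_C, zero_add, totalDegree_X]

omit [Fintype ι] [DecidableEq ι] in
/-- Substituting polynomials of total degree `≤ 1` does not increase the total degree (cf.
`totalDegree_aeval_le_of_le_one` of `BurgisserBooleanParts.lean`, restated privately to keep this
file's imports within Mathlib). [folklore] -/
private theorem totalDegree_bind₁_le_of_le_one {τ : Type*} (h : ι → MvPolynomial τ K)
    (hh : ∀ i, (h i).totalDegree ≤ 1) (p : MvPolynomial ι K) :
    (bind₁ h p).totalDegree ≤ p.totalDegree := by
  classical
  conv_lhs => rw [p.as_sum]
  rw [map_sum]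
  refine (totalDegree_finsetSum _ _).trans (Finset.sup_le fun d hd => ?_)
  rw [bind₁_monomial]
  refine (totalDegree_mul _ _).trans ?_
  rw [totalDegree_C, zero_add]
  refine (totalDegree_finsetProd _ _).trans ?_
  calc ∑ i ∈ d.support, (h i ^ d i).totalDegree ≤ ∑ i ∈ d.support, d i := by
        refine Finset.sum_le_sum fun i _ => ?_
        calc (h i ^ d i).totalDegree ≤ d i * (h i).totalDegree := totalDegree_pow _ _
          _ ≤ d i * 1 := Nat.mul_le_mul_left _ (hh i)
          _ = d i := mul_one _
    _ ≤ p.totalDegree := le_totalDegree hd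

/-- **Bürgisser's simplex lemma** (Bürgisser 2000 TCS, Lemma 4.2, p. 80): "Let `U_1, …, U_t` be
proper linear subspaces of `ℚ^{s+1}` and let `Δ_s(t) = {a ∈ ℕ^{s+1} | ∑_σ a_σ = t}` be the set of
lattice points of an `s`-dimensional simplex. Then we have `Δ_s(t) ⊄ U_1 ∪ U_2 ∪ ⋯ ∪ U_t`." Stated
for an arbitrary field `K` of characteristic zero in place of `ℚ` and a finite index type `ι` in
place of `{0, …, s}`: for every family of `t` proper subspaces `U_τ ⊊ K^ι` there is a lattice point
`a ∈ ℕ^ι` with `∑_j a_j = t` lying (after the cast `ℕ → K`) in none of the `U_τ`. Proof by the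
polynomial method (product of linear functionals, dehomogenisation, Alon's Combinatorial
Nullstellensatz), see the module docstring; the printed proof is an induction on `s + t`.
[cite: Burgisser2000TCS, Lemma 4.2 p. 80] -/
theorem exists_simplexLatticePoint_forall_not_mem [CharZero K] {t : ℕ}
    (U : Fin t → Submodule K (ι → K)) (hU : ∀ τ, U τ ≠ ⊤) :
    ∃ a : ι → ℕ, ∑ j, a j = t ∧ ∀ τ, (fun j => (a j : K)) ∉ U τ := by
  classical
  -- a nonzero functional vanishing on each `U τ`
  have hf : ∀ τ, ∃ f : (ι → K) →ₗ[K] K, f ≠ 0 ∧ U τ ≤ LinearMap.ker f := fun τ =>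
    Submodule.exists_le_ker_of_lt_top _ (lt_top_iff_ne_top.2 (hU τ))
  choose f hf0 hfU using hf
  -- it suffices to find `a` with all `f τ a ≠ 0`
  suffices h : ∃ a : ι → ℕ, ∑ j, a j = t ∧ ∀ τ, f τ (fun j => (a j : K)) ≠ 0 by
    obtain ⟨a, ha, hne⟩ := h
    exact ⟨a, ha, fun τ hmem => hne τ (LinearMap.mem_ker.1 (hfU τ hmem))⟩
  -- the case `t = 0`
  rcases Nat.eq_zero_or_pos t with rfl | ht
  · exact ⟨fun _ => 0, by simp, fun τ => τ.elim0⟩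
  -- `ι` is nonempty: a zero space has no proper subspace
  rcases isEmpty_or_nonempty ι with hι | ⟨⟨j₀⟩⟩
  · exfalso
    refine hf0 ⟨0, ht⟩ (LinearMap.ext fun x => ?_)
    have hx : x = 0 := funext fun j => (hι.false j).elim
    rw [hx, map_zero, LinearMap.zero_apply]
  -- the linear forms as polynomials and their product `P`
  set L : Fin t → MvPolynomial ι K :=
    fun τ => ∑ j, C (f τ fun j' => if j = j' then 1 else 0) * X j with hL
  have hLeval : ∀ τ x, eval x (L τ) = f τ x := fun τ x => eval_sum_C_mul_X_eq_apply (f τ) x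
  set P : MvPolynomial ι K := ∏ τ, L τ with hP
  have hPeval : ∀ x, eval x P = ∏ τ, f τ x := fun x => by
    rw [hP, map_prod]
    exact Finset.prod_congr rfl fun τ _ => hLeval τ x
  have hPdeg : P.totalDegree ≤ t := by
    refine (totalDegree_finsetProd _ _).trans ?_
    calc ∑ τ, (L τ).totalDegree ≤ ∑ _τ : Fin t, 1 :=
          Finset.sum_le_sum fun τ _ => totalDegree_sum_C_mul_X_le_one _
      _ = t := by simp
  have hPsmul : ∀ (c : K) (x : ι → K), eval (c • x) P = c ^ t * eval x P := fun c x => by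
    rw [hPeval, hPeval]
    simp_rw [map_smul, smul_eq_mul]
    rw [Finset.prod_mul_distrib, Finset.prod_const, Finset.card_univ, Fintype.card_fin]
  have hL0 : ∀ τ, L τ ≠ 0 := fun τ h0 => hf0 τ (LinearMap.ext fun x => by
    rw [← hLeval τ x, h0, map_zero, LinearMap.zero_apply])
  have hP0 : P ≠ 0 := by rw [hP]; exact Finset.prod_ne_zero_iff.2 fun τ _ => hL0 τ
  -- dehomogenisation along the hyperplane `∑_j x_j = t`: substitute `X_{j₀} := t - ∑_{j ≠ j₀} X_j`
  set g : ι → MvPolynomial {j // j ≠ j₀} K :=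
    fun j => if h : j = j₀ then C (t : K) - ∑ k, X k else X ⟨j, h⟩ with hg
  set ext : ({j // j ≠ j₀} → K) → ι → K :=
    fun b j => if h : j = j₀ then (t : K) - ∑ k, b k else b ⟨j, h⟩ with hext
  have hgeval : ∀ b j, eval b (g j) = ext b j := by
    intro b j
    simp only [hg, hext]
    split_ifs with h
    · rw [map_sub, eval_C, map_sum]
      simp only [eval_X]
    · rw [eval_X]
  have hg1 : ∀ j, (g j).totalDegree ≤ 1 := by
    intro j
    simp only [hg]
    split_ifs with h
    · refine (totalDegree_sub _ _).trans (max_le ?_ ?_)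
      · rw [totalDegree_C]; exact Nat.zero_le _
      · refine (totalDegree_finsetSum _ _).trans (Finset.sup_le fun k _ => ?_)
        rw [totalDegree_X]
    · rw [totalDegree_X]
  set Q : MvPolynomial {j // j ≠ j₀} K := bind₁ g P with hQ
  have hQeval : ∀ b, eval b Q = eval (ext b) P := fun b => by
    rw [hQ]
    change eval₂Hom (RingHom.id K) b (bind₁ g P) = eval₂Hom (RingHom.id K) (ext b) P
    rw [eval₂Hom_bind₁]
    have hfun : (fun i => eval₂Hom (RingHom.id K) b (g i)) = ext b := funext fun j => hgeval b j
    rw [hfun]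
  have hQdeg : Q.totalDegree ≤ t := (totalDegree_bind₁_le_of_le_one g hg1 P).trans hPdeg
  -- the extension of the restriction of a point of the hyperplane is the point
  have hsub : ∀ x : ι → K, ∑ k : {j // j ≠ j₀}, x k = ∑ j, x j - x j₀ := fun x => by
    rw [Fintype.sum_eq_add_sum_subtype_ne x j₀]; ring
  -- `Q ≠ 0`
  have hQ0 : Q ≠ 0 := by
    intro hQ0
    -- `P` vanishes wherever the coordinate sum is nonzero
    have hvan : ∀ x : ι → K, ∑ j, x j ≠ 0 → eval x P = 0 := by
      intro x hs
      set c : K := (t : K) / ∑ j, x j with hc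
      have hct : c * ∑ j, x j = t := div_mul_cancel₀ _ hs
      have hc0 : c ≠ 0 := div_ne_zero (Nat.cast_ne_zero.2 ht.ne') hs
      set b : {j // j ≠ j₀} → K := fun k => c * x k with hb
      have hxb : ext b = c • x := by
        funext j
        simp only [hext]
        split_ifs with h
        · subst h
          rw [Pi.smul_apply, smul_eq_mul]
          have h1 : ∑ k : {j' // j' ≠ j}, c * x k = c * ∑ j', x j' - c * x j := by
            rw [hsub (fun j' => c * x j'), Finset.mul_sum]
          rw [hb, h1, hct]
          ring
        · rw [hb, Pi.smul_apply, smul_eq_mul]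
      have h1 : eval b Q = 0 := by rw [hQ0, map_zero]
      rw [hQeval, hxb, hPsmul] at h1
      exact (mul_eq_zero.1 h1).resolve_left (pow_ne_zero _ hc0)
    -- hence `P * ∑_j X_j = 0`, a contradiction
    have hPS : P * ∑ j, X j = 0 := by
      apply MvPolynomial.funext
      intro x
      rw [map_mul, map_zero, map_sum]
      simp only [eval_X]
      by_cases hs : ∑ j, x j = 0
      · rw [hs, mul_zero]
      · rw [hvan x hs, zero_mul]
    rcases mul_eq_zero.1 hPS with h | h
    · exact hP0 h
    · have h1 := congr_arg (eval fun j => if j = j₀ then (1 : K) else 0) h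
      rw [map_sum, map_zero] at h1
      simp only [eval_X, Finset.sum_ite_eq', Finset.mem_univ, if_true] at h1
      exact one_ne_zero h1
  -- a monomial of top degree of `Q`
  obtain ⟨m₀, hm₀, hdeg⟩ : ∃ m₀ ∈ Q.support, Q.totalDegree = m₀.degree :=
    Finset.exists_mem_eq_sup Q.support (support_nonempty.2 hQ0) _
  -- Combinatorial Nullstellensatz on the grid `∏_k {0, …, m₀ k}`
  set S : {j // j ≠ j₀} → Finset K :=
    fun k => (Finset.range (m₀ k + 1)).image (Nat.cast : ℕ → K) with hS
  have hScard : ∀ k, m₀ k < #(S k) := fun k => by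
    rw [hS, Finset.card_image_of_injective _ Nat.cast_injective, Finset.card_range]
    exact Nat.lt_succ_self _
  obtain ⟨b, hbS, hbQ⟩ :=
    combinatorial_nullstellensatz_exists_eval_nonzero Q m₀ (mem_support_iff.1 hm₀) hdeg S hScard
  -- natural coordinates `n k ≤ m₀ k` of `b`
  have hbn : ∀ k, ∃ n : ℕ, n ≤ m₀ k ∧ (n : K) = b k := fun k => by
    obtain ⟨n, hn, hnb⟩ := Finset.mem_image.1 (hbS k)
    exact ⟨n, Nat.lt_succ_iff.1 (Finset.mem_range.1 hn), hnb⟩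
  choose n hnle hnb using hbn
  have hsum_le : ∑ k, n k ≤ t := by
    calc ∑ k, n k ≤ ∑ k, m₀ k := Finset.sum_le_sum fun k _ => hnle k
      _ = m₀.degree := (Finsupp.degree_eq_sum m₀).symm
      _ = Q.totalDegree := hdeg.symm
      _ ≤ t := hQdeg
  -- the lattice point `a = (t - ∑ n, n)`
  set a : ι → ℕ := fun j => if h : j = j₀ then t - ∑ k, n k else n ⟨j, h⟩ with ha
  have haj₀ : a j₀ = t - ∑ k, n k := by rw [ha]; exact dif_pos rfl
  have hak : ∀ k : {j // j ≠ j₀}, a k = n k := fun k => by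
    rw [ha]
    exact dif_neg k.2
  refine ⟨a, ?_, fun τ => ?_⟩
  · rw [Fintype.sum_eq_add_sum_subtype_ne a j₀, haj₀]
    simp_rw [hak]
    exact Nat.sub_add_cancel hsum_le
  · have hval : (fun j => (a j : K)) = ext b := by
      funext j
      simp only [hext]
      split_ifs with h
      · subst h
        rw [haj₀, Nat.cast_sub hsum_le, Nat.cast_sum]
        simp_rw [hnb]
      · rw [← hnb ⟨j, h⟩, ← hak ⟨j, h⟩]
    rw [hval]
    have hprod : ∏ τ, f τ (ext b) ≠ 0 := by rw [← hPeval, ← hQeval]; exact hbQ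
    exact (Finset.prod_ne_zero_iff.1 hprod) τ (Finset.mem_univ τ)

/-- **Bürgisser's simplex lemma**, finset form (Bürgisser 2000 TCS, Lemma 4.2, p. 80): for a finite
set `𝒰` of at most `t` proper subspaces of `K^ι` (`ι` nonempty and finite, `K` of characteristic
zero) there is a lattice point `a ∈ ℕ^ι` with `∑_j a_j = t` lying in no member of `𝒰`. (Pad `𝒰`
with copies of the proper subspace `⊥` and apply `exists_simplexLatticePoint_forall_not_mem`.)
[cite: Burgisser2000TCS, Lemma 4.2 p. 80] -/
theorem exists_simplexLatticePoint_forall_not_mem_finset [CharZero K] [Nonempty ι] {t : ℕ}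
    (𝒰 : Finset (Submodule K (ι → K))) (h𝒰 : ∀ U ∈ 𝒰, U ≠ ⊤) (hcard : 𝒰.card ≤ t) :
    ∃ a : ι → ℕ, ∑ j, a j = t ∧ ∀ U ∈ 𝒰, (fun j => (a j : K)) ∉ U := by
  classical
  -- enumerate `𝒰` by `Fin 𝒰.card` and pad with `⊥`
  set e := 𝒰.equivFin with he
  set U : Fin t → Submodule K (ι → K) :=
    fun τ => if h : (τ : ℕ) < 𝒰.card then (e.symm ⟨τ, h⟩ : Submodule K (ι → K)) else ⊥ with hUdef
  have hbot : (⊥ : Submodule K (ι → K)) ≠ ⊤ := by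
    obtain ⟨j⟩ := ‹Nonempty ι›
    intro h
    have hmem : (fun _ => (1 : K)) ∈ (⊥ : Submodule K (ι → K)) := by rw [h]; exact Submodule.mem_top
    rw [Submodule.mem_bot] at hmem
    exact one_ne_zero (congr_fun hmem j)
  have hU : ∀ τ, U τ ≠ ⊤ := fun τ => by
    simp only [hUdef]
    split_ifs with h
    · exact h𝒰 _ (e.symm ⟨τ, h⟩).2
    · exact hbot
  obtain ⟨a, ha, hne⟩ := exists_simplexLatticePoint_forall_not_mem U hU
  refine ⟨a, ha, fun V hV hmem => ?_⟩
  have hlt : ((e ⟨V, hV⟩ : Fin 𝒰.card) : ℕ) < t := lt_of_lt_of_le (e ⟨V, hV⟩).2 hcard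
  refine hne ⟨_, hlt⟩ ?_
  simp only [hUdef, dif_pos (e ⟨V, hV⟩).2, Fin.eta, Equiv.symm_apply_apply]
  exact hmem

end Literature.Computability.AlgebraicComplexity

end
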